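import Literature.NumberTheory.Automorphic.RankinSelbergTorusIntegral
import Literature.NumberTheory.Automorphic.MirabolicEisensteinSeries
import Literature.NumberTheory.Automorphic.GLnAdelicStructureProofs
import HarnessLib

/-!
# The standard Rankin–Selberg test function `Φ_∞ ⊗ 𝟙_{𝒪̂ⁿ}` is a Schwartz–Bruhat function

Topic `NumberTheory/Automorphic`; namespace `Literature.NumberTheory.Automorphic`. Proof file
(theorems only) bridging the real-valued test function `standardTestFun n K Φ_∞` of
`RankinSelbergTorusIntegral` (Jacquet–Shalika (1981), (5.1): `Φ` unramified outside `S`, here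
`Φ_v = 𝟙_{𝒪_vⁿ}` at every finite place) and the Schwartz–Bruhat space
`𝒮(𝔸_Kⁿ) = adelicSchwartzBruhat K n` of `MirabolicEisensteinSeries` on which the Eisenstein series
theory (`MirabolicEisensteinConvergence`, `…Majorant`, `…Continuity`, `RankinSelbergSiegelFiniteness`)
is stated:

* `isClopen_integralFiniteAdeleVec`, `isCompact_integralFiniteAdeleVec` — `𝒪̂ⁿ ⊆ (𝔸_K^∞)ⁿ` is
  compact open (`isOpen_integralFiniteAdeles`, `isCompact_integralFiniteAdeles`);
* `ofReal_standardTestFun_eq`, `ofReal_standardTestFun_mem_adelicSchwartzBruhat` — if the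
  archimedean factor is a (real-valued) factorizable Schwartz function,
  `Φ_∞(z) = ∏_w Φ_w`, read through `K_∞ ≃ K ⊗ ℝ`, then
  `y ↦ (standardTestFun n K Φ_∞ y : ℂ)` is the standard Schwartz–Bruhat function
  `Φ_∞(y_∞) 𝟙_{𝒪̂ⁿ}(y_f)` (`isStandardSchwartzBruhat_mul_indicator`), hence lies in `𝒮(𝔸_Kⁿ)`.

Folklore (Bump (1997), §3.1; Cogdell (2004), §2.3).
-/

noncomputable section

open scoped NNReal
open NumberField NumberField.mixedEmbedding IsDedekindDomain Set

namespace Literature.NumberTheory.Automorphic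

variable (n : ℕ) (K : Type) [Field K] [NumberField K]

/-! ### `𝒪̂ⁿ` is compact open -/

/-- `𝒪̂ⁿ = {z : ∀ i v, z_i,v ∈ 𝒪_v}` is the box `∏_i 𝒪̂`. [folklore] -/
theorem setOf_forall_mem_integers_eq_pi :
    {z : Fin n → FiniteAdeleRing (𝓞 K) K | ∀ (i : Fin n) (w : HeightOneSpectrum (𝓞 K)),
        z i w ∈ w.adicCompletionIntegers K} =
      Set.pi Set.univ fun _ : Fin n => (integralFiniteAdeles K : Set (FiniteAdeleRing (𝓞 K) K)) := by
  ext z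
  simp only [Set.mem_setOf_eq, Set.mem_univ_pi]
  exact Iff.rfl

/-- `𝒪̂ⁿ ⊆ (𝔸_K^∞)ⁿ` is compact. [folklore] -/
theorem isCompact_integralFiniteAdeleVec :
    IsCompact {z : Fin n → FiniteAdeleRing (𝓞 K) K | ∀ (i : Fin n) (w : HeightOneSpectrum (𝓞 K)),
        z i w ∈ w.adicCompletionIntegers K} := by
  rw [setOf_forall_mem_integers_eq_pi]
  exact isCompact_univ_pi fun _ => isCompact_integralFiniteAdeles K

/-- `𝒪̂ⁿ ⊆ (𝔸_K^∞)ⁿ` is compact open, hence clopen. [folklore] -/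
theorem isClopen_integralFiniteAdeleVec :
    IsClopen {z : Fin n → FiniteAdeleRing (𝓞 K) K | ∀ (i : Fin n) (w : HeightOneSpectrum (𝓞 K)),
        z i w ∈ w.adicCompletionIntegers K} := by
  haveI : T2Space (FiniteAdeleRing (𝓞 K) K) := inferInstanceAs <| T2Space
    (RestrictedProduct (fun w : HeightOneSpectrum (𝓞 K) => w.adicCompletion K)
      (fun w => (w.adicCompletionIntegers K : Set (w.adicCompletion K))) Filter.cofinite)
  refine ⟨(isCompact_integralFiniteAdeleVec n K).isClosed, ?_⟩
  rw [setOf_forall_mem_integers_eq_pi]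
  exact isOpen_set_pi Set.finite_univ fun _ _ => isOpen_integralFiniteAdeles K

/-! ### The standard test function as a Schwartz–Bruhat function -/

variable {n K}

/-- If `(Φ_∞ z : ℂ) = ∏_w Φ_w (e(z))` for factorizable archimedean Schwartz data `(Φ_w)`, then
`(standardTestFun n K Φ_∞ y : ℂ) = (∏_w Φ_w)(y_∞) · 𝟙_{𝒪̂ⁿ}(y_f)`. [folklore] -/
theorem ofReal_standardTestFun_eq {Φinf : (Fin n → InfiniteAdeleRing K) → ℝ}
    {Φr : {w : InfinitePlace K // w.IsReal} → SchwartzMap (Fin n → ℝ) ℂ}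
    {Φc : {w : InfinitePlace K // w.IsComplex} → SchwartzMap (Fin n → ℂ) ℂ}
    (hΦinf : ∀ z : Fin n → InfiniteAdeleRing K, ((Φinf z : ℝ) : ℂ) =
      archSchwartzFun K n Φr Φc fun i => InfiniteAdeleRing.ringEquiv_mixedSpace K (z i))
    (y : Fin n → AdeleRing (𝓞 K) K) :
    ((standardTestFun n K Φinf y : ℝ) : ℂ) =
      archSchwartzFun K n Φr Φc (vecInfinitePart K n y) *
        {z : Fin n → FiniteAdeleRing (𝓞 K) K | ∀ (i : Fin n) (w : HeightOneSpectrum (𝓞 K)),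
            z i w ∈ w.adicCompletionIntegers K}.indicator 1 (vecFinitePart K n y) := by
  unfold standardTestFun
  by_cases h : ∀ (i : Fin n) (w : HeightOneSpectrum (𝓞 K)), (y i).2 w ∈ w.adicCompletionIntegers K
  · have hmem : vecFinitePart K n y ∈ {z : Fin n → FiniteAdeleRing (𝓞 K) K |
        ∀ (i : Fin n) (w : HeightOneSpectrum (𝓞 K)), z i w ∈ w.adicCompletionIntegers K} := h
    rw [if_pos h, hΦinf, Set.indicator_of_mem hmem, Pi.one_apply, mul_one]
    rfl
  · have hmem : vecFinitePart K n y ∉ {z : Fin n → FiniteAdeleRing (𝓞 K) K |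
        ∀ (i : Fin n) (w : HeightOneSpectrum (𝓞 K)), z i w ∈ w.adicCompletionIntegers K} := h
    rw [if_neg h, Set.indicator_of_notMem hmem, mul_zero, Complex.ofReal_zero]

/-- **`Φ_∞ ⊗ 𝟙_{𝒪̂ⁿ} ∈ 𝒮(𝔸_Kⁿ)`**: under the same hypothesis the complexified standard test
function is a standard Schwartz–Bruhat function (`isStandardSchwartzBruhat_mul_indicator` with the
compact open `𝒪̂ⁿ`), hence lies in `adelicSchwartzBruhat K n`. [cite: Bump1997, §3.1] -/
theorem ofReal_standardTestFun_mem_adelicSchwartzBruhat {Φinf : (Fin n → InfiniteAdeleRing K) → ℝ}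
    {Φr : {w : InfinitePlace K // w.IsReal} → SchwartzMap (Fin n → ℝ) ℂ}
    {Φc : {w : InfinitePlace K // w.IsComplex} → SchwartzMap (Fin n → ℂ) ℂ}
    (hΦinf : ∀ z : Fin n → InfiniteAdeleRing K, ((Φinf z : ℝ) : ℂ) =
      archSchwartzFun K n Φr Φc fun i => InfiniteAdeleRing.ringEquiv_mixedSpace K (z i)) :
    IsStandardSchwartzBruhat K n (fun y => ((standardTestFun n K Φinf y : ℝ) : ℂ)) ∧
      (fun y => ((standardTestFun n K Φinf y : ℝ) : ℂ)) ∈ adelicSchwartzBruhat K n := by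
  have heq : (fun y => ((standardTestFun n K Φinf y : ℝ) : ℂ)) = fun y =>
      archSchwartzFun K n Φr Φc (vecInfinitePart K n y) *
        {z : Fin n → FiniteAdeleRing (𝓞 K) K | ∀ (i : Fin n) (w : HeightOneSpectrum (𝓞 K)),
            z i w ∈ w.adicCompletionIntegers K}.indicator 1 (vecFinitePart K n y) :=
    funext (ofReal_standardTestFun_eq hΦinf)
  have hst : IsStandardSchwartzBruhat K n (fun y => ((standardTestFun n K Φinf y : ℝ) : ℂ)) := by
    rw [heq]
    exact isStandardSchwartzBruhat_mul_indicator Φr Φc (isClopen_integralFiniteAdeleVec n K)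
      (isCompact_integralFiniteAdeleVec n K)
  exact ⟨hst, hst.mem_adelicSchwartzBruhat⟩

end Literature.NumberTheory.Automorphic
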